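import Mathlib.Geometry.Manifold.Instances.Real
import Literature.Geometry.Lorentzian.LorentzianMetric
import Literature.Geometry.Lorentzian.Isometry
import Literature.Geometry.Lorentzian.KerrSchild
import HarnessLib

-- D-0014 sorry-sweep (operator, 2026-08-13): sorried theorems -> named facts `def X : Prop`; partial proofs preserved in comments
-- provenance: harness21/H21/H21/Prelude/Lorentz/Extension.lean @ c3fce92 (interim HEAD d8f2665); M5 mechanical rewrite
/-!
# `Cᵏ`-extendibility of Lorentzian manifolds (trunk G08 = T-LORENTZ, item C21)

Notion `lorentzian_extendibility_C0`. Following Sbierski (J. Differential Geom. **108** (2018),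
Def. 2.1), a **`Cᵏ`-extension** of a connected smooth Lorentzian manifold `(M, g)` of dimension
`d` is a smooth isometric embedding `ι : M → M'` into a connected `d`-dimensional Lorentzian
manifold `(M', g')` whose metric `g'` is only `Cᵏ`, such that `ι(M) ⊊ M'` is a proper subset.
`(M, g)` is **`Cᵏ`-inextendible** if no such extension exists. `C⁰`-inextendibility of the
maximal globally hyperbolic development is the conclusion of the modern (Christodoulou)
formulation of the strong cosmic censorship conjecture (statement gr.S22, whose bold tag lives in
`H21/Statements/GR/CosmicCensorship.lean`), and Sbierski's theorem (2018, Thm. 1) is that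
Minkowski space (and maximal analytic Schwarzschild) is `C⁰`-inextendible.

## Contents
* `LorentzianManifold.IsExtension 𝓜 𝓜' ι`: `ι` is a smooth open isometric embedding of `𝓜` into
  the `Cⁿ` Lorentzian manifold `𝓜'` with `range ι ≠ univ`;
* `LorentzianManifold.IsExtendible n 𝓜`, `LorentzianManifold.IsC0Inextendible 𝓜`,
  `LorentzianManifold.IsC2Inextendible 𝓜`, `Spacetime.IsC0Inextendible 𝓢`;
* `LorentzianManifold.ofLE` (lower the recorded metric regularity) and
  `LorentzianManifold.isExtendible_mono` (a `Cⁿ`-extension is a `Cⁿ'`-extension for `n' ≤ n`);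
* `minkowski_isC0Inextendible` (Sbierski 2018, Thm. 1; proof `sorry`).

## Design notes
* Mathlib has no notion of (in)extendibility of pseudo-Riemannian manifolds
  (`rg -i inextend Mathlib` is empty); we use Mathlib's `ContMDiff`, `Topology.IsOpenEmbedding`
  and H21's `pullbackBilin` (file `Isometry.lean`).
* Since `dim M = dim M'`, a smooth embedding `ι` is automatically open (invariance of domain);
  we record `IsOpenEmbedding ι` directly rather than `Manifold.IsSmoothEmbedding`, which keeps
  the definition elementary, and add smoothness `ContMDiff (𝓡 d) (𝓡 d) ∞ ι` separately. The
  isometry condition `ι^* g' = g` is stated with `pullbackBilin`.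
* Sbierski does not require `M'` to be time-orientable; neither do we (`𝓜'` is a bare
  `LorentzianManifold d n`, connected, Hausdorff and second countable by the bundled instances).
* The extension `𝓜'` is quantified in the **same universe** as `𝓜` (as for MGHD maximality,
  outline §1 (g)); every `d`-manifold has a representative in any universe, so nothing is lost.
* **Not formalised:** Christodoulou's variant of strong cosmic censorship asks for
  inextendibility with `g' ∈ C⁰` and Christoffel symbols in `L²_loc` (Christodoulou, *The
  formation of black holes in general relativity*, 2009, p. 7; Dafermos–Luk 2017, §1). This needs
  weak derivatives of tensor fields on manifolds, which Mathlib lacks; only the `Cᵏ` scale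
  (`k : ℕ∞ω`) is provided here.

## References
* J. Sbierski, *The `C⁰`-inextendibility of the Schwarzschild spacetime and the spacelike
  diameter in Lorentzian geometry*, J. Differential Geom. 108 (2018), 319–378, Def. 2.1, Thm. 1.
* D. Christodoulou, *The formation of black holes in general relativity*, EMS 2009, Prologue.
* M. Dafermos, J. Luk, *The interior of dynamical vacuum black holes I*, arXiv:1710.01722, §1.
-/

noncomputable section

open Bundle TopologicalSpace Topology
open scoped Manifold ContDiff

namespace Literature.Geometry.Lorentzian

universe u

variable {d : ℕ} {n n' : ℕ∞ω}

namespace LorentzianManifold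

/-- Lower the recorded regularity of the metric of a bundled Lorentzian manifold: a `Cⁿ`
Lorentzian manifold is a `Cⁿ'` Lorentzian manifold for `n' ≤ n` (same carrier, same metric
values; via `LorentzianMetric.ofLE`). O'Neill 1983, Ch. 3, Def. 3.1.
[cite: ONeillSemiRiemannian1983, Ch. 3 Def. 3.1] -/
def ofLE (𝓜 : LorentzianManifold.{u} d n) (h : n' ≤ n) : LorentzianManifold.{u} d n' where
  carrier := 𝓜.carrier
  metric := 𝓜.metric.ofLE h

/-- `ofLE` does not change the carrier. O'Neill 1983, Ch. 3, Def. 3.1.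
[cite: ONeillSemiRiemannian1983, Ch. 3 Def. 3.1] -/
@[simp]
lemma carrier_ofLE (𝓜 : LorentzianManifold.{u} d n) (h : n' ≤ n) : (𝓜.ofLE h).carrier = 𝓜.carrier :=
  rfl

/-- `ofLE` does not change the metric values. O'Neill 1983, Ch. 3, Def. 3.1.
[cite: ONeillSemiRiemannian1983, Ch. 3 Def. 3.1] -/
@[simp]
lemma metric_val_ofLE (𝓜 : LorentzianManifold.{u} d n) (h : n' ≤ n) :
    (𝓜.ofLE h).metric.val = 𝓜.metric.val :=
  rfl

/-- `ι : M → M'` is a **`Cⁿ`-extension** of the smooth connected Lorentzian `d`-manifold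
`𝓜 = (M, g)` by the connected Lorentzian `d`-manifold `𝓜' = (M', g')` with `Cⁿ` metric
(Sbierski, J. Differential Geom. 108 (2018), Def. 2.1): `ι` is smooth, `ι` is an open
topological embedding (automatic for smooth embeddings in equal dimension), `ι` is isometric
(`ι^* g' = g` pointwise, via `pullbackBilin`), and `ι(M) ⊊ M'` is a proper subset. [folklore] -/
def IsExtension (𝓜 : LorentzianManifold.{u} d ∞) (𝓜' : LorentzianManifold.{u} d n)
    (ι : 𝓜.carrier → 𝓜'.carrier) : Prop :=
  ContMDiff (𝓡 d) (𝓡 d) ∞ ι ∧ IsOpenEmbedding ι ∧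
    (∀ x, pullbackBilin (I := 𝓡 d) (I' := 𝓡 d) ι 𝓜'.metric.val x = 𝓜.metric.val x) ∧
    Set.range ι ≠ Set.univ

/-- The smooth connected Lorentzian manifold `𝓜` is **`Cⁿ`-extendible** if it admits a
`Cⁿ`-extension `ι : 𝓜 → 𝓜'` (Sbierski 2018, Def. 2.1). The extension is quantified in the
universe of `𝓜`. [cite: SbierskiJDG2018, Def. 2.1] -/
def IsExtendible (n : ℕ∞ω) (𝓜 : LorentzianManifold.{u} d ∞) : Prop :=
  ∃ (𝓜' : LorentzianManifold.{u} d n) (ι : 𝓜.carrier → 𝓜'.carrier), IsExtension 𝓜 𝓜' ι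

/-- `𝓜` is **`C⁰`-inextendible**: it admits no extension by a Lorentzian manifold with merely
continuous metric (Sbierski 2018, Def. 2.1; the conclusion of Christodoulou's formulation of
strong cosmic censorship, gr.S22). The `C⁰ + L²_loc`-Christoffel refinement is not formalised.
[cite: SbierskiJDG2018, Def. 2.1] -/
def IsC0Inextendible (𝓜 : LorentzianManifold.{u} d ∞) : Prop :=
  ¬ IsExtendible 0 𝓜

/-- `𝓜` is **`C²`-inextendible**: it admits no extension by a Lorentzian manifold with `C²`
metric (the classical regularity in Penrose's strong cosmic censorship; Sbierski 2018, Def. 2.1;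
Dafermos–Luk 2017, §1). [cite: SbierskiJDG2018, Def. 2.1] -/
def IsC2Inextendible (𝓜 : LorentzianManifold.{u} d ∞) : Prop :=
  ¬ IsExtendible 2 𝓜

variable {𝓜 : LorentzianManifold.{u} d ∞}

/-- An extension map is smooth (Sbierski 2018, Def. 2.1). [cite: SbierskiJDG2018, Def. 2.1] -/
lemma IsExtension.contMDiff {𝓜' : LorentzianManifold.{u} d n} {ι : 𝓜.carrier → 𝓜'.carrier}
    (h : IsExtension 𝓜 𝓜' ι) : ContMDiff (𝓡 d) (𝓡 d) ∞ ι :=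
  h.1

/-- An extension map is an open embedding (Sbierski 2018, Def. 2.1).
[cite: SbierskiJDG2018, Def. 2.1] -/
lemma IsExtension.isOpenEmbedding {𝓜' : LorentzianManifold.{u} d n}
    {ι : 𝓜.carrier → 𝓜'.carrier} (h : IsExtension 𝓜 𝓜' ι) : IsOpenEmbedding ι :=
  h.2.1

/-- An extension map is isometric: `ι^* g' = g` (Sbierski 2018, Def. 2.1).
[cite: SbierskiJDG2018, Def. 2.1] -/
lemma IsExtension.pullbackBilin_eq {𝓜' : LorentzianManifold.{u} d n}
    {ι : 𝓜.carrier → 𝓜'.carrier} (h : IsExtension 𝓜 𝓜' ι) (x : 𝓜.carrier) :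
    pullbackBilin (I := 𝓡 d) (I' := 𝓡 d) ι 𝓜'.metric.val x = 𝓜.metric.val x :=
  h.2.2.1 x

/-- The image of an extension map is a proper subset (Sbierski 2018, Def. 2.1).
[cite: SbierskiJDG2018, Def. 2.1] -/
lemma IsExtension.range_ne_univ {𝓜' : LorentzianManifold.{u} d n}
    {ι : 𝓜.carrier → 𝓜'.carrier} (h : IsExtension 𝓜 𝓜' ι) : Set.range ι ≠ Set.univ :=
  h.2.2.2

/-- A `Cⁿ`-extension is a `Cⁿ'`-extension for `n' ≤ n`, after lowering the recorded regularity
of the target (Sbierski 2018, remark after Def. 2.1).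
[cite: SbierskiJDG2018, remark after Def. 2.1] -/
lemma IsExtension.ofLE {𝓜' : LorentzianManifold.{u} d n} {ι : 𝓜.carrier → 𝓜'.carrier}
    (h : IsExtension 𝓜 𝓜' ι) (hn : n' ≤ n) :
    IsExtension 𝓜 (𝓜'.ofLE hn) ι :=
  h

/-- **Monotonicity of extendibility**: a `Cⁿ`-extendible Lorentzian manifold is
`Cⁿ'`-extendible for every `n' ≤ n`; equivalently `Cⁿ'`-inextendibility implies
`Cⁿ`-inextendibility (Sbierski 2018, remark after Def. 2.1: `C⁰`-inextendibility is the
strongest notion). [cite: SbierskiJDG2018, remark after Def. 2.1 (C⁰-inextendibility is the strongest notion)] -/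
theorem isExtendible_mono (hn : n' ≤ n) (h : IsExtendible n 𝓜) : IsExtendible n' 𝓜 := by
  obtain ⟨𝓜', ι, hι⟩ := h
  exact ⟨𝓜'.ofLE hn, ι, hι.ofLE hn⟩

/-- `C⁰`-inextendibility implies `C²`-inextendibility (Sbierski 2018, remark after Def. 2.1).
[cite: SbierskiJDG2018, remark after Def. 2.1] -/
lemma IsC0Inextendible.isC2Inextendible (h : IsC0Inextendible 𝓜) : IsC2Inextendible 𝓜 :=
  fun h2 ↦ h (isExtendible_mono bot_le h2)

end LorentzianManifold

namespace Spacetime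

/-- A spacetime is **`C⁰`-inextendible** if its underlying (time-oriented, hence a fortiori)
Lorentzian manifold is (Sbierski 2018, Def. 2.1; conclusion of strong cosmic censorship in
Christodoulou's formulation, gr.S22). [cite: SbierskiJDG2018, Def. 2.1] -/
def IsC0Inextendible (𝓢 : Spacetime.{u} d) : Prop :=
  𝓢.toLorentzianManifold.IsC0Inextendible

/-- Unfolding lemma for `Spacetime.IsC0Inextendible` (Sbierski 2018, Def. 2.1).
[cite: SbierskiJDG2018, Def. 2.1] -/
lemma isC0Inextendible_iff (𝓢 : Spacetime.{u} d) :
    𝓢.IsC0Inextendible ↔ 𝓢.toLorentzianManifold.IsC0Inextendible :=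
  Iff.rfl

end Spacetime

/-- **Sbierski's theorem** (J. Differential Geom. 108 (2018), Thm. 1 (i)): Minkowski spacetime
`(ℝ⁴, η)` is `C⁰`-inextendible.
[cite: SbierskiJDG2018, §3, Theorem ((d+1)-dimensional Minkowski spacetime is C⁰-inextendible, d ≥ 1; arXiv:1507.00601v2)] -/
def minkowski_isC0Inextendible : Prop :=
  Minkowski.spacetime.IsC0Inextendible

end Literature.Geometry.Lorentzian

end
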